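/-
Copyright: lit-balaban Phase-2 proof seat p31 (gen 3).  Statement-level skeleton of a published paper; no proof claims beyond what the
kernel checks below.
-/
import Literature.MathematicalPhysics.QuantumFieldTheory.BalabanImbrieJaffe1984to88.BIJ85Eq454Holonomy
import Literature.MathematicalPhysics.QuantumFieldTheory.BalabanImbrieJaffe1984to88.BIJ85Eq224Base0

/-!
# `BalabanImbrieJaffe1984to88.BIJ85Eq454HolonomyBase0` — T. Bałaban, J. Imbrie, A. Jaffe, *Renormalization of the Higgs model: minimizers,
propagators and the stability of mean field theory*, Commun. Math. Phys. **97** (1985) 299–329 [BalabanImbrieJaffe1985]: the plaquette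
variables of `Q^{s*}_kv` (4.5.2)–(4.5.3) and of the background field `u_k` (4.5.4) (Remark 2 p. 317) AT A NAMED COARSE LEVEL and AT BASE 0
for the k-fold composites — sibling of `BIJ85Eq454Holonomy`

statement-level skeleton of published theorems with citation tags; proofs where landed; nothing here is a claim about the Yang–Mills mass gap

PDF held: `paper:balaban1985-cmp97-bij-higgs-minimizers` (journal page = PDF page + 298).  Pages read as images:
`run/shared/lean/pub/lit-balaban/lit-balaban-r15/pages/1985-cmp97-bij-higgs-minimizers-p014-x2.png` (p. 312), `…-p015-x2.png` (p. 313),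
`…-p019-x2.png` (p. 317).

CITATION HEADER (lean-in-tree rule).  Part of the lit-balaban TYPED SKELETON (HOME `run/shared/lean/pub/lit-balaban/`), Phase-2 seat p31
(gen 3); rows **C1.Eq4.5.4** / **C1.Rem@317** of `HOME/SKELETON.md` (reader file `HOME/lit-balaban-r15/ROWS-C1.md`).  WHAT IS REPRODUCED:
the identities of `BIJ85Eq454Holonomy` — p. 312 (4.5.3) *"(Q^{s*}_kv)_b = 1 if b is strictly contained in a k-block …, v_c if the η-lattice
bond b belongs to the corridor of bonds connecting the two blocks B^k(c₋) and B^k(c₊)"* exponentiated to plaquettes, `(Q^{s*}_kv)(∂p) =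
v(∂p′)` for `p ∈ B^e_k(p′)` and `1` otherwise, and p. 317 Remark 2 *"u_k(∂p) = exp[ie_kη²Q^{e*}_kf^{(k)} − ie_kη²∂𝒟_k∂^*Q^{e*}_kf^{(k)}]"*
with its Lie-algebra form (5.2.12) — TRANSPORTED (i) to the named-coarse-level geometries `BIJ85Eq224Base0.torusBlockBondsTo P i k n h` /
`torusEdgeCellsTo` (`subst h`), and (ii) at base 0 to seat p30's k-fold COMPOSITES `BIJ85Eq531Inputs.QsstarIter k` / `QestarIter hd k` (the
vocabulary in which (5.3.1) `BIJ85Eq531Proof` and the inputs of (6.2.1) are stated), via `BIJ85Eq224Base0.QsstarIter_eq` / `QestarIter_eq`.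
U(1) fields and plaquette variables are `BIJ85Sect1Model.U1Field`/`plaq`, `u = exp(iaA)` is `BIJ85SmallFieldSplit64.expField a A`, the plaquette
field `(ia)^{−1} ln u(∂·)` with the branch (2.11) is `plaqField a u`; `X` = the supplied η-lattice bond field (𝒟_k∂^*Q^{e*}_kf^{(k)} in the paper),
`∂ = curl η⁻¹`.  Standing range `n ≤ m + K` / `k ≤ m + K`, `2 ≤ d`, `ηL^k = 1`, `e ≠ 0` where a logarithm is divided.  NOTHING beyond the
kernel-checked identities is asserted.  Unit `lit-balaban-p31` (literature-prover-lit-balaban-p31-g3-0), 2026-08-21.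
-/

open scoped BigOperators Real

namespace Literature.MathematicalPhysics.QuantumFieldTheory.BalabanImbrieJaffe1984to88.BIJ85Eq454HolonomyBase0

open Literature.MathematicalPhysics.QuantumFieldTheory.Balaban1983to89
open BIJ85Sect2SurfaceAverages BIJ85CellAverages LatticeFieldCalculus BIJ85Eq219Proof BIJ85CurlQsstar BIJ85Eq224Proof
  BIJ85Eq224ProofPart2 BIJ85Eq224Base0 BIJ85Sect1Model BIJ85SmallFieldSplit64 BIJ85Eq454Holonomy

variable {P : Params} {i : ℕ}

/-! ## 1. Named coarse level `n = i + k` -/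

/-- `(Q^{s*}_kv)(∂p) = v(∂p′)` for `p ∈ B^e_k(p′)` at a NAMED coarse level `n = i + k` (transport of `plaq_QsstarU1_of_mem` along `h`; `ηL^k = 1`;
standing range, `2 ≤ d`). [cite: BalabanImbrieJaffe1985, (4.5.3) p.312] -/
theorem plaq_QsstarToU1_of_mem {k n : ℕ} (h : i + k = n) (hn : n ≤ P.m + P.K) (hd : 2 ≤ P.d) (e η : ℝ) (hη : η * (P.L : ℝ) ^ k = 1)
    (B : PBond P n → ℝ) {p : Plaq P i} {p' : Plaq P n} (hp : p ∈ (torusEdgeCellsTo P i k n h hd).B p') :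
    plaq (expField (e * η) ((torusBlockBondsTo P i k n h).Qsstar B)) p = plaq (expField e B) p' := by
  subst h
  exact plaq_QsstarU1_of_mem hd hn e η hη B hp

/-- … `= 1` off the edge plaquettes, at a named coarse level (standing range, `2 ≤ d`). [cite: BalabanImbrieJaffe1985, (4.5.3) p.312] -/
theorem plaq_QsstarToU1_of_not_mem {k n : ℕ} (h : i + k = n) (hn : n ≤ P.m + P.K) (hd : 2 ≤ P.d) (a : ℝ) (B : PBond P n → ℝ)
    {p : Plaq P i} (hp : ∀ p', p ∉ (torusEdgeCellsTo P i k n h hd).B p') :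
    plaq (expField a ((torusBlockBondsTo P i k n h).Qsstar B)) p = 1 := by
  subst h
  exact plaq_QsstarU1_of_not_mem hd hn a B hp

/-- Remark 2's holonomy of (4.5.4) at a named coarse level: `u_k(∂p) = exp[ie_kη²((Q^{e*}_kf^{(k)})(p) − (∂X)(p))]` (transport of
`plaq_background_eq_exp`; `e ≠ 0`, `ηL^k = 1`; standing range, `2 ≤ d`). [cite: BalabanImbrieJaffe1985, (5.2.12) p.317] -/
theorem plaq_backgroundTo_eq_exp {k n : ℕ} (h : i + k = n) (hn : n ≤ P.m + P.K) (hd : 2 ≤ P.d) {e : ℝ} (he : e ≠ 0) (η : ℝ)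
    (hη : η * (P.L : ℝ) ^ k = 1) (B : PBond P n → ℝ) (X : PBond P i → ℝ) (p : Plaq P i) :
    plaq (expField (e * η) (fun b => (torusBlockBondsTo P i k n h).Qsstar B b - X b)) p =
      Circle.exp (e * η ^ 2 * ((torusEdgeCellsTo P i k n h hd).Qstar (plaqField e (expField e B)) p - curl η⁻¹ X p)) := by
  subst h
  exact plaq_background_eq_exp hd hn he η hη B X p

/-- (5.2.12) at a named coarse level: `(ie_kη²)^{−1} ln u_k(∂p) = (Q^{e*}_kf^{(k)})(p) − (∂X)(p)` inside the branch (transport of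
`plaqField_background`; `e ≠ 0`, `ηL^k = 1`; standing range, `2 ≤ d`). [cite: BalabanImbrieJaffe1985, (5.2.12) p.317] -/
theorem plaqField_backgroundTo {k n : ℕ} (h : i + k = n) (hn : n ≤ P.m + P.K) (hd : 2 ≤ P.d) {e : ℝ} (he : e ≠ 0) (η : ℝ)
    (hη : η * (P.L : ℝ) ^ k = 1) (B : PBond P n → ℝ) (X : PBond P i → ℝ) (p : Plaq P i)
    (hsmall : |e * η ^ 2 * ((torusEdgeCellsTo P i k n h hd).Qstar (plaqField e (expField e B)) p - curl η⁻¹ X p)| < π) :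
    plaqField (e * η ^ 2) (expField (e * η) (fun b => (torusBlockBondsTo P i k n h).Qsstar B b - X b)) p =
      (torusEdgeCellsTo P i k n h hd).Qstar (plaqField e (expField e B)) p - curl η⁻¹ X p := by
  subst h
  exact plaqField_background hd hn he η hη B X p hsmall

/-! ## 2. Base 0: the composites `BIJ85Eq531Inputs.QsstarIter k` / `QestarIter hd k` -/

/-- AT BASE 0, for seat p30's composite `Q^{s*}_k = (Q^{s*})^k` (`BIJ85Eq531Inputs.QsstarIter k`, bond fields of the unit lattice `T^{(k)}` →
bond fields of `T^{(0)} = T_η`): `(Q^{s*}_kv)(∂p) = v(∂p′)` for `p ∈ B^e_k(p′)`, the edge set of the block-size-`L^k` geometry from `T^{(0)}`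
(`BIJ85Eq224Base0.torusEdgeCellsTo P 0 k k _`); `(Q^{s*}_kv)_b = exp(ie_kη(Q^{s*}_kB)_b)`, `ηL^k = 1`, `v = exp(ie_kB)` (standing range `k ≤ m + K`,
`2 ≤ d`). [cite: BalabanImbrieJaffe1985, (4.5.3) p.312] -/
theorem plaq_QsstarIter531U1_of_mem (hd : 2 ≤ P.d) {k : ℕ} (hk : k ≤ P.m + P.K) (e η : ℝ) (hη : η * (P.L : ℝ) ^ k = 1)
    (B : PBond P k → ℝ) {p : Plaq P 0} {p' : Plaq P k} (hp : p ∈ (torusEdgeCellsTo P 0 k k (Nat.zero_add k) hd).B p') :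
    plaq (expField (e * η) (BIJ85Eq531Inputs.QsstarIter k B)) p = plaq (expField e B) p' := by
  rw [QsstarIter_eq k hk B]
  exact plaq_QsstarToU1_of_mem (Nat.zero_add k) hk hd e η hη B hp

/-- … and `(Q^{s*}_kv)(∂p) = 1` off the edge plaquettes, for the composite `BIJ85Eq531Inputs.QsstarIter k` (standing range, `2 ≤ d`).
[cite: BalabanImbrieJaffe1985, (4.5.3) p.312] -/
theorem plaq_QsstarIter531U1_of_not_mem (hd : 2 ≤ P.d) {k : ℕ} (hk : k ≤ P.m + P.K) (a : ℝ) (B : PBond P k → ℝ) {p : Plaq P 0}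
    (hp : ∀ p', p ∉ (torusEdgeCellsTo P 0 k k (Nat.zero_add k) hd).B p') :
    plaq (expField a (BIJ85Eq531Inputs.QsstarIter k B)) p = 1 := by
  rw [QsstarIter_eq k hk B]
  exact plaq_QsstarToU1_of_not_mem (Nat.zero_add k) hk hd a B hp

/-- Remark 2's holonomy of (4.5.4) AT BASE 0 in the composite vocabulary: for `u_k = exp(ie_kη(Q^{s*}_kB − X))` with `Q^{s*}_k` =
`BIJ85Eq531Inputs.QsstarIter k` and `Q^{e*}_k` = `BIJ85Eq531Inputs.QestarIter hd k`, `u_k(∂p) = exp[ie_kη²((Q^{e*}_kf^{(k)})(p) − (∂X)(p))]`,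
`f^{(k)} = (ie_k)^{−1} ln v(∂·)`, `∂ = curl η⁻¹`; `e ≠ 0`, `ηL^k = 1` (standing range, `2 ≤ d`). [cite: BalabanImbrieJaffe1985, (5.2.12) p.317] -/
theorem plaq_background531_eq_exp (hd : 2 ≤ P.d) {k : ℕ} (hk : k ≤ P.m + P.K) {e : ℝ} (he : e ≠ 0) (η : ℝ)
    (hη : η * (P.L : ℝ) ^ k = 1) (B : PBond P k → ℝ) (X : PBond P 0 → ℝ) (p : Plaq P 0) :
    plaq (expField (e * η) (fun b => BIJ85Eq531Inputs.QsstarIter k B b - X b)) p =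
      Circle.exp (e * η ^ 2 * (BIJ85Eq531Inputs.QestarIter hd k (plaqField e (expField e B)) p - curl η⁻¹ X p)) := by
  rw [QsstarIter_eq k hk B, QestarIter_eq hd k hk]
  exact plaq_backgroundTo_eq_exp (Nat.zero_add k) hk hd he η hη B X p

/-- (5.2.12) AT BASE 0 in the composite vocabulary: `(ie_kη²)^{−1} ln u_k(∂p) = (Q^{e*}_kf^{(k)})(p) − (∂X)(p)` inside the branch (2.11), with
`Q^{s*}_k`/`Q^{e*}_k` = `BIJ85Eq531Inputs.QsstarIter k`/`QestarIter hd k` — the torus-model content of the hypothesis `hhol` of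
`BIJ85Eq427Proof.eq5212` (`X` = 𝒟_k∂^*Q^{e*}_kf^{(k)}); `e ≠ 0`, `ηL^k = 1` (standing range, `2 ≤ d`). [cite: BalabanImbrieJaffe1985, (5.2.12) p.317] -/
theorem plaqField_background531 (hd : 2 ≤ P.d) {k : ℕ} (hk : k ≤ P.m + P.K) {e : ℝ} (he : e ≠ 0) (η : ℝ)
    (hη : η * (P.L : ℝ) ^ k = 1) (B : PBond P k → ℝ) (X : PBond P 0 → ℝ) (p : Plaq P 0)
    (hsmall : |e * η ^ 2 * (BIJ85Eq531Inputs.QestarIter hd k (plaqField e (expField e B)) p - curl η⁻¹ X p)| < π) :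
    plaqField (e * η ^ 2) (expField (e * η) (fun b => BIJ85Eq531Inputs.QsstarIter k B b - X b)) p =
      BIJ85Eq531Inputs.QestarIter hd k (plaqField e (expField e B)) p - curl η⁻¹ X p := by
  rw [QestarIter_eq hd k hk] at hsmall
  rw [QsstarIter_eq k hk B, QestarIter_eq hd k hk]
  exact plaqField_backgroundTo (Nat.zero_add k) hk hd he η hη B X p hsmall

end Literature.MathematicalPhysics.QuantumFieldTheory.BalabanImbrieJaffe1984to88.BIJ85Eq454HolonomyBase0
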